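import Summits.SmoothPoincare4.SmoothPoincare4.Theses.EntropyRung
import Summits.SmoothPoincare4.SmoothPoincare4.Theorems.EntropyRungSubcylindricalExistenceSphereSideClause
import Summits.SmoothPoincare4.SmoothPoincare4.Theorems.EntropyRungSubcylindricalExistenceSphereSideClauseAux
import Summits.SmoothPoincare4.SmoothPoincare4.Theorems.EntropyRungSubcylindricalExistenceSphereSideClauseSchwarzschildAux
import Summits.SmoothPoincare4.SmoothPoincare4.Theorems.EntropyRungSubcylindricalExistenceGradSqFlatChart
import Summits.SmoothPoincare4.SmoothPoincare4.Theorems.EntropyRungSubcylindricalExistenceSetIntegralFlatChart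
import HarnessLib

/-!
# The cap clause in the flat gauge with mass: transfer of the Euclidean perturbative cap clause
through the flat chart (stub `stub_sphereSideClauseSchwarzschild`, S2'M, line
`green-blowup-conformal-entropy`, reshape R-c3 "Schwarzschild gauge", crux
`EntropyRung.SubcylindricalExistence`, item stmt-SmoothPoincare4-10871)

Let `(g, p, G)` be Green data on a closed 4-manifold of the summit binder (`G` smooth and positive
off `p`, `R_g G − 6 Δ_g G = 0` off `p`) with `R_g ≥ 0`, in the flat gauge WITH MASS at `p`: the
extended chart `φ` at `p` inverts to a `g`-isometry on the closed ball `B̄(y₀, r)` (`y₀ = φ p`) and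
`G ∘ φ⁻¹ = a/‖y − y₀‖² + b` on the punctured ball (`a > 0`, `b ≥ 0` constant). For `K > 0` let `ψ`
be smooth with `ψ = 4KG/(4K+G)` off `p` and `ψ(p) = 4K`. Assuming, BY TEXT, the Euclidean
perturbative cap clause (stub E2 of the skeleton: weight `Ψ(z) = 4K(a + b‖z‖²)/((4K+b)‖z‖² + a)`,
curvature weight `12a²/(K(a + b‖z‖²)³)`, level `log 6 − 2 − 100θ` for test functions supported in
`B(0, ρ₁)` when `θ ≤ 1/100`, `bρ₁² ≤ θa`, `b ≤ θK`), we prove: for `0 < ρ₁ ≤ r`, every `τ > 0` and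
every smooth `v` supported in the open chart ball of radius `ρ₁` with `∫ (4πτ)⁻² v² ψ⁴ dV_g = 1`,
`log 6 − 2 − 100θ ≤ ∫ [τ(ψ⁻³ L_g ψ · v² + 4 ψ⁻² |∇v|²_g) − v² log v² − 4 v²] (4πτ)⁻² ψ⁴ dV_g`,
`L_g ψ = R_g ψ − 6 Δ_g ψ`.

Proof (verbatim the transport of lead c2's `SphereSideClause.sphereSideClause'`, the case `b = 0`).
In the chart, `ψ ∘ φ⁻¹ (y) = Ψ(y − y₀)`. Off `p`, `ψ = θ ∘ G` with the Möbius profile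
`θ(s) = 4K − 16K²/(4K+s)`, so the chain rule `Δ_g(θ∘G) = θ''(G)|∇G|² + θ'(G) Δ_g G`
(`dalembertian_real_comp`), the Green equation `6 Δ_g G = R_g G`,
`θ(s) − s θ'(s) = 4Ks²/(4K+s)² ≥ 0`, `R_g ≥ 0` and `|∇G|²_g = ‖∇(a/‖·−y₀‖² + b)‖² = 4a²/‖y−y₀‖⁶` (landed flat-chart gradient identity S0,
`stub_gradSqFlatChart`) give, with `n = ‖y − y₀‖²`, `s = G = a/n + b`, `ns = a + bn`,
`ψ⁻³ L_g ψ ≥ 768K²a²/(n³(4K+s)³ψ³) = 12a²/(K(a + bn)³)` on the punctured ball (`cap_algebra_mass`,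
`curv_bound_mass` of the helper file `…SphereSideClauseSchwarzschildAux.lean`); the point `p` is
`dV_g`-null. The integrand vanishes off the closed chart ball,
where `dV_g` is Lebesgue measure (landed S0b, `stub_setIntegralFlatChart`) and
`|∇v|²_g = ‖∇(v∘φ⁻¹)‖²` (S0); after the translation `y ↦ y − y₀` the functional with the curvature
weight frozen at `12a²/(K(a + b‖φ x − y₀‖²)³)` is exactly the Euclidean functional of E2 at the SAME
scale `τ` for the compactly supported smooth extension of `v ∘ φ⁻¹`, supported in `B(0, ρ₁)`, and
the `R`-term only helps. References: Schoen 1984 (flat conformal gauge, `G = a/|y|² + A + O(|y|)`);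
Lee–Parker 1987, §3 and §6; Perelman 2002, §3 (the `𝒲`-functional); O'Neill 1983, Ch. 3 (chain
rule for `Δ_g`). [folklore]
-/

noncomputable section

-- the registered namespace `Summit.SmoothPoincare4.SmoothPoincare4.Theorems` repeats a component
set_option linter.dupNamespace false

open scoped Manifold ContDiff Topology RealInnerProductSpace
open Set Filter MeasureTheory
open Literature.Geometry.Lorentzian Literature.Geometry.Riemannian

namespace Summit.SmoothPoincare4.SmoothPoincare4.Theorems

namespace SphereSideClauseSchwarzschild

open SphereSideClause CapFactorRound

/-! ### The clause on the cap side -/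

/-- **The cap clause in the flat gauge with mass (workhorse form of
`stub_sphereSideClauseSchwarzschild`).** See the module docstring; `hE2` is the by-text statement of
the Euclidean perturbative cap clause (stub E2 of the skeleton). [folklore] -/
theorem sphereSideClauseSchwarzschild'
    (hE2 : ∀ (K a b ρ₁ θ : ℝ), 0 < K → 0 < a → 0 ≤ b → 0 < ρ₁ → 0 < θ → θ ≤ 1 / 100 →
      b * ρ₁ ^ 2 ≤ θ * a → b ≤ θ * K →
      ∀ τ : ℝ, 0 < τ → ∀ v : EuclideanSpace ℝ (Fin 4) → ℝ, ContDiff ℝ ∞ v →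
      tsupport v ⊆ Metric.ball 0 ρ₁ →
      ∫ z, (4 * Real.pi * τ) ^ (-(4 : ℝ) / 2) * (v z) ^ 2 * (4 * K * (a + b * ‖z‖ ^ 2) / ((4 * K + b) * ‖z‖ ^ 2 + a)) ^ 4 = 1 →
        Real.log 6 - 2 - 100 * θ ≤
          ∫ z, (τ * ((12 * a ^ 2 / (K * (a + b * ‖z‖ ^ 2) ^ 3)) * (v z) ^ 2
                + 4 * ((4 * K * (a + b * ‖z‖ ^ 2) / ((4 * K + b) * ‖z‖ ^ 2 + a))⁻¹ ^ 2 * ‖gradient v z‖ ^ 2))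
              - (v z) ^ 2 * Real.log ((v z) ^ 2) - 4 * (v z) ^ 2)
              * ((4 * Real.pi * τ) ^ (-(4 : ℝ) / 2) * (4 * K * (a + b * ‖z‖ ^ 2) / ((4 * K + b) * ‖z‖ ^ 2 + a)) ^ 4))
    {M : Type} [TopologicalSpace M] [T2Space M] [SecondCountableTopology M]
    [ChartedSpace (EuclideanSpace ℝ (Fin 4)) M] [IsManifold (𝓡 4) ∞ M] [CompactSpace M]
    [T3Space M] [MeasurableSpace M] [BorelSpace M]
    (g : PseudoRiemannianMetric (𝓡 4) ∞ (EuclideanSpace ℝ (Fin 4)) (TangentSpace (𝓡 4) : M → Type _))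
    [g.HasLeviCivita] (hg : g.IsRiemannian) (hR : ∀ x, 0 ≤ g.scalarCurvature x)
    {p : M} {G : M → ℝ} (hGs : ContMDiffOn (𝓡 4) 𝓘(ℝ, ℝ) ∞ G {p}ᶜ) (hGpos : ∀ x, x ≠ p → 0 < G x)
    (hGreen : ∀ x, x ≠ p → g.scalarCurvature x * G x - 6 * g.dalembertian G x = 0)
    {a b r : ℝ} (ha : 0 < a) (hb : 0 ≤ b) (hr : 0 < r)
    (hball : Metric.closedBall (extChartAt (𝓡 4) p p) r ⊆ (extChartAt (𝓡 4) p).target)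
    (hflat : ∀ y ∈ Metric.closedBall (extChartAt (𝓡 4) p p) r, ∀ X W : EuclideanSpace ℝ (Fin 4),
      g.val ((extChartAt (𝓡 4) p).symm y)
        (mfderiv 𝓘(ℝ, EuclideanSpace ℝ (Fin 4)) (𝓡 4) (extChartAt (𝓡 4) p).symm y X)
        (mfderiv 𝓘(ℝ, EuclideanSpace ℝ (Fin 4)) (𝓡 4) (extChartAt (𝓡 4) p).symm y W) = ⟪X, W⟫)
    (hGchart : ∀ y ∈ Metric.closedBall (extChartAt (𝓡 4) p p) r, y ≠ extChartAt (𝓡 4) p p →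
      G ((extChartAt (𝓡 4) p).symm y) = a / ‖y - extChartAt (𝓡 4) p p‖ ^ 2 + b)
    {K : ℝ} (hK : 0 < K) {ψ : M → ℝ} (hψs : ContMDiff (𝓡 4) 𝓘(ℝ, ℝ) ∞ ψ)
    (hψ : ∀ x, x ≠ p → ψ x = 4 * K * G x / (4 * K + G x)) (hψp : ψ p = 4 * K)
    {ρ₁ θ : ℝ} (hρ₁ : 0 < ρ₁) (hρ₁r : ρ₁ ≤ r) (hθ : 0 < θ) (hθ1 : θ ≤ 1 / 100)
    (hbρ : b * ρ₁ ^ 2 ≤ θ * a) (hbK : b ≤ θ * K)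
    {τ : ℝ} (hτ : 0 < τ) {v : M → ℝ} (hv : ContMDiff (𝓡 4) 𝓘(ℝ, ℝ) ∞ v)
    (hsupp : tsupport v ⊆ {x | x ∈ (extChartAt (𝓡 4) p).source ∧
      extChartAt (𝓡 4) p x ∈ Metric.ball (extChartAt (𝓡 4) p p) ρ₁})
    (hnorm : ∫ x, (4 * Real.pi * τ) ^ (-(4 : ℝ) / 2) * (v x) ^ 2 * (ψ x) ^ 4
      ∂(riemannianMeasure (g.toContMDiffRiemannianMetric hg)) = 1) :
    Real.log 6 - 2 - 100 * θ ≤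
      ∫ x, (τ * ((ψ x ^ 3)⁻¹ * (g.scalarCurvature x * ψ x - 6 * g.dalembertian ψ x) * (v x) ^ 2
            + 4 * ((ψ x)⁻¹ ^ 2 * g.gradSq v x))
          - (v x) ^ 2 * Real.log ((v x) ^ 2) - 4 * (v x) ^ 2)
          * ((4 * Real.pi * τ) ^ (-(4 : ℝ) / 2) * (ψ x) ^ 4)
        ∂(riemannianMeasure (g.toContMDiffRiemannianMetric hg)) := by
  have hS0 := stub_gradSqFlatChart M g p
  have hS0b := stub_setIntegralFlatChart M g hg p r hr hball hflat
  /- positivity and continuity -/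
  have hψpos : ∀ x, 0 < ψ x := by
    intro x
    by_cases hx : x = p
    · rw [hx, hψp]; positivity
    · rw [hψ x hx]; have := hGpos x hx; positivity
  have hψne : ∀ x, ψ x ≠ 0 := fun x ↦ (hψpos x).ne'
  have hψc : Continuous ψ := hψs.continuous
  have hvc : Continuous v := hv.continuous
  have hRc : Continuous g.scalarCurvature := g.contMDiff_scalarCurvature.continuous
  have hΔc : Continuous (g.dalembertian ψ) :=
    continuous_dalembertian g (hψs.of_le (WithTop.coe_le_coe.mpr le_top))
  have hQc : Continuous (g.gradSq v) := (contMDiff_gradSq g hv).continuous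
  have hφc : ContinuousOn (extChartAt (𝓡 4) p) (extChartAt (𝓡 4) p).source :=
    continuousOn_extChartAt p
  have hφo : IsOpen (extChartAt (𝓡 4) p).source := isOpen_extChartAt_source p
  /- the support of `v` -/
  have hbr : Metric.ball (extChartAt (𝓡 4) p p) ρ₁ ⊆ Metric.closedBall (extChartAt (𝓡 4) p p) r :=
    Metric.ball_subset_closedBall.trans (Metric.closedBall_subset_closedBall hρ₁r)
  have hsub : tsupport v ⊆ (extChartAt (𝓡 4) p).source := fun x hx ↦ (hsupp hx).1
  have hv0 : ∀ x, x ∉ {x | x ∈ (extChartAt (𝓡 4) p).source ∧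
      extChartAt (𝓡 4) p x ∈ Metric.closedBall (extChartAt (𝓡 4) p p) r} →
      v x = 0 ∧ g.gradSq v x = 0 := by
    intro x hx
    have hx' : x ∉ tsupport v := fun h ↦ hx ⟨(hsupp h).1, hbr (hsupp h).2⟩
    refine ⟨image_eq_zero_of_notMem_tsupport hx', ?_⟩
    have hev : v =ᶠ[𝓝 x] fun _ ↦ (0 : ℝ) := notMem_tsupport_iff_eventuallyEq.1 hx'
    rw [show g.gradSq v x = g.gradSq (fun _ : M ↦ (0 : ℝ)) x by
      simp only [PseudoRiemannianMetric.gradSq, mvfderiv_congr_of_eventuallyEq hev]]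
    exact g.gradSq_const 0 x
  have himg : extChartAt (𝓡 4) p '' tsupport v ⊆ Metric.ball (extChartAt (𝓡 4) p p) ρ₁ := by
    rintro _ ⟨x, hx, rfl⟩
    exact (hsupp hx).2
  have hKc : IsClosed (extChartAt (𝓡 4) p '' tsupport v) :=
    (isCompact_image_tsupport p hsub).isClosed
  /- the chart extension of `v` -/
  have hVcd := chartExt_contDiff p hv hsub
  have hVsupp := chartExt_support_subset p v
  have hVapply : ∀ y ∈ Metric.closedBall (extChartAt (𝓡 4) p p) r,
      (extChartAt (𝓡 4) p).target.indicator (v ∘ (extChartAt (𝓡 4) p).symm) y =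
        v ((extChartAt (𝓡 4) p).symm y) := fun y hy ↦ indicator_of_mem (hball hy) _
  have hVgrad : ∀ y ∈ Metric.closedBall (extChartAt (𝓡 4) p p) r,
      g.gradSq v ((extChartAt (𝓡 4) p).symm y) =
        ‖gradient ((extChartAt (𝓡 4) p).target.indicator (v ∘ (extChartAt (𝓡 4) p).symm))
          y‖ ^ 2 := by
    intro y hy
    rw [hS0 y (hball hy) (hflat y hy) v (hv.mdifferentiableAt (by simp)),
      (chartExt_eventuallyEq p v (hball hy)).gradient_eq]
  have hVzero : ∀ y, y ∉ Metric.closedBall (extChartAt (𝓡 4) p p) r →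
      (extChartAt (𝓡 4) p).target.indicator (v ∘ (extChartAt (𝓡 4) p).symm) y = 0 ∧
      gradient ((extChartAt (𝓡 4) p).target.indicator (v ∘ (extChartAt (𝓡 4) p).symm)) y = 0 :=
    fun y hy ↦ chartExt_eq_zero p hsub fun h ↦ hy (hbr (himg h))
  /- `ψ` in the chart and the curvature weight -/
  have hψchart : ∀ y ∈ Metric.closedBall (extChartAt (𝓡 4) p p) r,
      ψ ((extChartAt (𝓡 4) p).symm y) =
        4 * K * (a + b * ‖y - extChartAt (𝓡 4) p p‖ ^ 2) /
          ((4 * K + b) * ‖y - extChartAt (𝓡 4) p p‖ ^ 2 + a) :=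
    fun y hy ↦ psi_chart_mass p ha hball hGchart hψ hψp hy
  have hcurv : ∀ y ∈ Metric.ball (extChartAt (𝓡 4) p p) r, y ≠ extChartAt (𝓡 4) p p →
      12 * a ^ 2 / (K * (a + b * ‖y - extChartAt (𝓡 4) p p‖ ^ 2) ^ 3) ≤
        (ψ ((extChartAt (𝓡 4) p).symm y) ^ 3)⁻¹ *
        (g.scalarCurvature ((extChartAt (𝓡 4) p).symm y) * ψ ((extChartAt (𝓡 4) p).symm y) -
          6 * g.dalembertian ψ ((extChartAt (𝓡 4) p).symm y)) :=
    fun y hy hy0 ↦ curv_bound_mass g hR hGs hGpos hGreen ha hb hball hflat hGchart hK hψ hy hy0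
  have hps : p ∈ (extChartAt (𝓡 4) p).source := mem_extChartAt_source p
  /- `p` is `dV_g`-null -/
  have hae : ∀ᵐ x ∂(riemannianMeasure (g.toContMDiffRiemannianMetric hg)), x ≠ p := by
    have hpt : riemannianMeasure (g.toContMDiffRiemannianMetric hg) {p} = 0 := by
      rw [riemannianMeasure_eq_integral_sqrt_det_holds (g.toContMDiffRiemannianMetric hg) p
        (measurableSet_singleton p) (singleton_subset_iff.2 hps), image_singleton]
      exact setLIntegral_measure_zero _ _ (measure_singleton _)
    have := measure_eq_zero_iff_ae_notMem.1 hpt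
    filter_upwards [this] with x hx
    simpa using hx
  clear hS0 hflat
  /- abstract the chart and the extension -/
  generalize hV : (extChartAt (𝓡 4) p).target.indicator (v ∘ (extChartAt (𝓡 4) p).symm) = V at *
  generalize hφ : extChartAt (𝓡 4) p = φ at *
  /- Step 1: the normalisation transported to `ℝ⁴` -/
  have hnormE : ∫ z : EuclideanSpace ℝ (Fin 4), (4 * Real.pi * τ) ^ (-(4 : ℝ) / 2) *
      (V (z + φ p)) ^ 2 * (4 * K * (a + b * ‖z‖ ^ 2) / ((4 * K + b) * ‖z‖ ^ 2 + a)) ^ 4 = 1 := by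
    have hT := transfer (F := fun x ↦ (4 * Real.pi * τ) ^ (-(4 : ℝ) / 2) * (v x) ^ 2 * (ψ x) ^ 4)
      (FE := fun y ↦ (4 * Real.pi * τ) ^ (-(4 : ℝ) / 2) * (V y) ^ 2 *
        (4 * K * (a + b * ‖y - φ p‖ ^ 2) / ((4 * K + b) * ‖y - φ p‖ ^ 2 + a)) ^ 4) hS0b
      (by fun_prop) (fun x hx ↦ by simp [(hv0 x hx).1])
      (fun y hy ↦ by simp only [hVapply y hy, hψchart y hy])
      (fun y hy ↦ by simp [(hVzero y hy).1])
    refine Eq.trans ?_ (hT.symm.trans hnorm)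
    refine integral_congr_ae (Eventually.of_forall fun z ↦ ?_)
    simp only [add_sub_cancel_right]
  /- Step 2: the Euclidean cap clause for the translated extension -/
  have hVtc : ContDiff ℝ ∞ fun z : EuclideanSpace ℝ (Fin 4) ↦ V (z + φ p) :=
    hVcd.comp (contDiff_id.add contDiff_const)
  have hsuppE : tsupport (fun z : EuclideanSpace ℝ (Fin 4) ↦ V (z + φ p)) ⊆ Metric.ball 0 ρ₁ := by
    refine (closure_minimal (t := (fun z ↦ z + φ p) ⁻¹' (φ '' tsupport v))
      (fun z hz ↦ hVsupp hz) (hKc.preimage (continuous_id.add continuous_const))).trans ?_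
    intro z hz
    have h := himg hz
    rw [Metric.mem_ball, dist_eq_norm, add_sub_cancel_right] at h
    exact mem_ball_zero_iff.2 h
  have hE := hE2 K a b ρ₁ θ hK ha hb hρ₁ hθ hθ1 hbρ hbK τ hτ (fun z ↦ V (z + φ p)) hVtc hsuppE
    hnormE
  /- Step 3: the `R`-frozen functional on `M` equals the Euclidean functional -/
  have hρv : Continuous fun x ↦ 12 * a ^ 2 / (K * (a + b * ‖φ x - φ p‖ ^ 2) ^ 3) * v x ^ 2 := by
    have hWc : Continuous fun y : EuclideanSpace ℝ (Fin 4) ↦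
        12 * a ^ 2 / (K * (a + b * ‖y - φ p‖ ^ 2) ^ 3) :=
      continuous_const.div (by fun_prop) fun y ↦ by positivity
    exact continuous_mul_sq_of_tsupport_subset hφo (hWc.comp_continuousOn hφc) hvc hsub
  have hΦ'c : Continuous fun x ↦ (τ * (12 * a ^ 2 / (K * (a + b * ‖φ x - φ p‖ ^ 2) ^ 3) * v x ^ 2
      + 4 * ((ψ x)⁻¹ ^ 2 * g.gradSq v x)) - v x ^ 2 * Real.log (v x ^ 2) - 4 * v x ^ 2) *
      ((4 * Real.pi * τ) ^ (-(4 : ℝ) / 2) * ψ x ^ 4) :=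
    continuous_density' hρv hvc hQc hψc hψne τ _
  have hT2 := transfer
    (F := fun x ↦ (τ * (12 * a ^ 2 / (K * (a + b * ‖φ x - φ p‖ ^ 2) ^ 3) * v x ^ 2
      + 4 * ((ψ x)⁻¹ ^ 2 * g.gradSq v x)) - v x ^ 2 * Real.log (v x ^ 2) - 4 * v x ^ 2) *
      ((4 * Real.pi * τ) ^ (-(4 : ℝ) / 2) * ψ x ^ 4))
    (FE := fun y ↦ (τ * (12 * a ^ 2 / (K * (a + b * ‖y - φ p‖ ^ 2) ^ 3) * V y ^ 2 +
        4 * ((4 * K * (a + b * ‖y - φ p‖ ^ 2) / ((4 * K + b) * ‖y - φ p‖ ^ 2 + a))⁻¹ ^ 2 *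
          ‖gradient V y‖ ^ 2))
      - V y ^ 2 * Real.log (V y ^ 2) - 4 * V y ^ 2) *
        ((4 * Real.pi * τ) ^ (-(4 : ℝ) / 2) *
          (4 * K * (a + b * ‖y - φ p‖ ^ 2) / ((4 * K + b) * ‖y - φ p‖ ^ 2 + a)) ^ 4))
    hS0b hΦ'c
    (fun x hx ↦ by simp [(hv0 x hx).1, (hv0 x hx).2])
    (fun y hy ↦ by simp only [hVapply y hy, hψchart y hy, hVgrad y hy, φ.right_inv (hball hy)])
    (fun y hy ↦ by simp [(hVzero y hy).1, (hVzero y hy).2])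
  have hS1' : Real.log 6 - 2 - 100 * θ ≤
      ∫ x, (τ * (12 * a ^ 2 / (K * (a + b * ‖φ x - φ p‖ ^ 2) ^ 3) * v x ^ 2
        + 4 * ((ψ x)⁻¹ ^ 2 * g.gradSq v x)) - v x ^ 2 * Real.log (v x ^ 2) - 4 * v x ^ 2) *
        ((4 * Real.pi * τ) ^ (-(4 : ℝ) / 2) * ψ x ^ 4)
        ∂(riemannianMeasure (g.toContMDiffRiemannianMetric hg)) := by
    rw [hT2]
    refine hE.trans_eq (integral_congr_ae (Eventually.of_forall fun z ↦ ?_))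
    simp only [gradient_comp_add_right V (φ p) z, add_sub_cancel_right]
  /- Step 4: the `R`-term only helps -/
  refine hS1'.trans (integral_mono_ae (EntropyLocalisation.integrable_of_continuous g hg hΦ'c)
    (EntropyLocalisation.integrable_of_continuous g hg ?_) ?_)
  · exact continuous_density (((hψc.pow 3).inv₀ fun x ↦ pow_ne_zero 3 (hψne x)).mul
      ((hRc.mul hψc).sub (continuous_const.mul hΔc))) hvc hQc hψc hψne τ _
  · filter_upwards [hae] with x hxp
    have hdiff : (τ * ((ψ x ^ 3)⁻¹ * (g.scalarCurvature x * ψ x - 6 * g.dalembertian ψ x) * v x ^ 2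
          + 4 * ((ψ x)⁻¹ ^ 2 * g.gradSq v x)) - v x ^ 2 * Real.log (v x ^ 2) - 4 * v x ^ 2)
          * ((4 * Real.pi * τ) ^ (-(4 : ℝ) / 2) * ψ x ^ 4)
        - (τ * (12 * a ^ 2 / (K * (a + b * ‖φ x - φ p‖ ^ 2) ^ 3) * v x ^ 2
          + 4 * ((ψ x)⁻¹ ^ 2 * g.gradSq v x)) - v x ^ 2 * Real.log (v x ^ 2) - 4 * v x ^ 2) *
          ((4 * Real.pi * τ) ^ (-(4 : ℝ) / 2) * ψ x ^ 4)
        = τ * ((ψ x ^ 3)⁻¹ * (g.scalarCurvature x * ψ x - 6 * g.dalembertian ψ x)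
            - 12 * a ^ 2 / (K * (a + b * ‖φ x - φ p‖ ^ 2) ^ 3))
          * v x ^ 2 * ((4 * Real.pi * τ) ^ (-(4 : ℝ) / 2) * ψ x ^ 4) := by ring
    rw [← sub_nonneg, hdiff]
    by_cases hvx : v x = 0
    · rw [hvx]
      simp
    · have hxt : x ∈ tsupport v := subset_tsupport v hvx
      obtain ⟨hxs, hxb⟩ := hsupp hxt
      have hy0 : φ x ≠ φ p := fun h ↦ hxp (φ.injOn hxs hps h)
      have hcx := hcurv (φ x) (Metric.ball_subset_ball hρ₁r hxb) hy0
      rw [φ.left_inv hxs] at hcx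
      have hc4 : 0 ≤ (4 * Real.pi * τ) ^ (-(4 : ℝ) / 2) * ψ x ^ 4 := by positivity
      exact mul_nonneg (mul_nonneg (mul_nonneg hτ.le (sub_nonneg.2 hcx)) (sq_nonneg _)) hc4

end SphereSideClauseSchwarzschild

open SphereSideClauseSchwarzschild in
/-- **Stub S2'M of line `green-blowup-conformal-entropy`, reshape R-c3 (the cap clause in the flat
gauge with mass, transferred from `ℝ⁴`).** Assuming by text the Euclidean perturbative cap clause
(stub E2): in the flat gauge at `p` (radius `r`, `G = a/‖y−y₀‖² + b` on the punctured ball,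
`a > 0`, `b ≥ 0`), for `R_g ≥ 0`, Green data `(g, p, G)`, `K > 0`, a smooth `ψ` with
`ψ = 4KG/(4K+G)` off `p`, `ψ(p) = 4K`, radii `0 < ρ₁ ≤ r` and `θ ≤ 1/100` with `bρ₁² ≤ θa`,
`b ≤ θK`: for every `τ > 0` and every smooth `v` supported in the open chart ball of radius `ρ₁`
with `∫ (4πτ)⁻² v² ψ⁴ dV_g = 1`,
`log 6 − 2 − 100θ ≤ ∫ [τ(ψ⁻³ L_g ψ · v² + 4ψ⁻²|∇v|²_g) − v² log v² − 4v²] (4πτ)⁻² ψ⁴ dV_g`.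
Schoen 1984 (flat conformal gauge); Lee–Parker 1987 §3, §6; Perelman 2002 §3. [folklore] -/
theorem stub_sphereSideClauseSchwarzschild :
    (∀ (K a b ρ₁ θ : ℝ), 0 < K → 0 < a → 0 ≤ b → 0 < ρ₁ → 0 < θ → θ ≤ 1 / 100 →
      b * ρ₁ ^ 2 ≤ θ * a → b ≤ θ * K →
      ∀ τ : ℝ, 0 < τ → ∀ v : EuclideanSpace ℝ (Fin 4) → ℝ, ContDiff ℝ ∞ v →
      tsupport v ⊆ Metric.ball 0 ρ₁ →
      ∫ z, (4 * Real.pi * τ) ^ (-(4 : ℝ) / 2) * (v z) ^ 2 * (4 * K * (a + b * ‖z‖ ^ 2) / ((4 * K + b) * ‖z‖ ^ 2 + a)) ^ 4 = 1 →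
        Real.log 6 - 2 - 100 * θ ≤
          ∫ z, (τ * ((12 * a ^ 2 / (K * (a + b * ‖z‖ ^ 2) ^ 3)) * (v z) ^ 2
                + 4 * ((4 * K * (a + b * ‖z‖ ^ 2) / ((4 * K + b) * ‖z‖ ^ 2 + a))⁻¹ ^ 2 * ‖gradient v z‖ ^ 2))
              - (v z) ^ 2 * Real.log ((v z) ^ 2) - 4 * (v z) ^ 2)
              * ((4 * Real.pi * τ) ^ (-(4 : ℝ) / 2) * (4 * K * (a + b * ‖z‖ ^ 2) / ((4 * K + b) * ‖z‖ ^ 2 + a)) ^ 4)) →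
    ∀ (M : Type) [TopologicalSpace M] [T2Space M] [SecondCountableTopology M]
      [ChartedSpace (EuclideanSpace ℝ (Fin 4)) M] [IsManifold (𝓡 4) ∞ M] [CompactSpace M]
      [T3Space M] [MeasurableSpace M] [BorelSpace M]
      (g : PseudoRiemannianMetric (𝓡 4) ∞ (EuclideanSpace ℝ (Fin 4)) (TangentSpace (𝓡 4) : M → Type _))
      [g.HasLeviCivita] (hg : g.IsRiemannian), (∀ x, 0 ≤ g.scalarCurvature x) →
      ∀ (p : M) (G : M → ℝ),
        (ContMDiffOn (𝓡 4) 𝓘(ℝ, ℝ) ∞ G {p}ᶜ ∧ (∀ x, x ≠ p → 0 < G x) ∧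
          (∀ x, x ≠ p → g.scalarCurvature x * G x - 6 * g.dalembertian G x = 0) ∧
          Tendsto G (𝓝[≠] p) atTop) →
      ∀ (a b r : ℝ), 0 < a → 0 ≤ b → 0 < r →
        Metric.closedBall (extChartAt (𝓡 4) p p) r ⊆ (extChartAt (𝓡 4) p).target →
        (∀ y ∈ Metric.closedBall (extChartAt (𝓡 4) p p) r, ∀ X W : EuclideanSpace ℝ (Fin 4),
          g.val ((extChartAt (𝓡 4) p).symm y)
            (mfderiv 𝓘(ℝ, EuclideanSpace ℝ (Fin 4)) (𝓡 4) (extChartAt (𝓡 4) p).symm y X)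
            (mfderiv 𝓘(ℝ, EuclideanSpace ℝ (Fin 4)) (𝓡 4) (extChartAt (𝓡 4) p).symm y W) = ⟪X, W⟫) →
        (∀ y ∈ Metric.closedBall (extChartAt (𝓡 4) p p) r, y ≠ extChartAt (𝓡 4) p p →
          G ((extChartAt (𝓡 4) p).symm y) = a / ‖y - extChartAt (𝓡 4) p p‖ ^ 2 + b) →
      ∀ (K : ℝ), 0 < K → ∀ (ψ : M → ℝ), ContMDiff (𝓡 4) 𝓘(ℝ, ℝ) ∞ ψ →
        (∀ x, x ≠ p → ψ x = 4 * K * G x / (4 * K + G x)) → ψ p = 4 * K →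
      ∀ (ρ₁ θ : ℝ), 0 < ρ₁ → ρ₁ ≤ r → 0 < θ → θ ≤ 1 / 100 → b * ρ₁ ^ 2 ≤ θ * a → b ≤ θ * K →
      ∀ τ : ℝ, 0 < τ → ∀ v : M → ℝ, ContMDiff (𝓡 4) 𝓘(ℝ, ℝ) ∞ v →
        tsupport v ⊆ {x | x ∈ (extChartAt (𝓡 4) p).source ∧
            extChartAt (𝓡 4) p x ∈ Metric.ball (extChartAt (𝓡 4) p p) ρ₁} →
        ∫ x, (4 * Real.pi * τ) ^ (-(4 : ℝ) / 2) * (v x) ^ 2 * (ψ x) ^ 4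
            ∂(riemannianMeasure (g.toContMDiffRiemannianMetric hg)) = 1 →
          Real.log 6 - 2 - 100 * θ ≤
            ∫ x, (τ * ((ψ x ^ 3)⁻¹ * (g.scalarCurvature x * ψ x - 6 * g.dalembertian ψ x) * (v x) ^ 2
                  + 4 * ((ψ x)⁻¹ ^ 2 * g.gradSq v x))
                - (v x) ^ 2 * Real.log ((v x) ^ 2) - 4 * (v x) ^ 2)
                * ((4 * Real.pi * τ) ^ (-(4 : ℝ) / 2) * (ψ x) ^ 4)
              ∂(riemannianMeasure (g.toContMDiffRiemannianMetric hg)) := by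
  intro hE2 M _ _ _ _ _ _ _ _ _ g _ hg hR p G hGreen a b r ha hb hr hball hflat hGchart K hK ψ hψs
    hψ hψp ρ₁ θ hρ₁ hρ₁r hθ hθ1 hbρ hbK τ hτ v hv hsupp hnorm
  exact sphereSideClauseSchwarzschild' hE2 g hg hR hGreen.1 hGreen.2.1 hGreen.2.2.1 ha hb hr hball
    hflat hGchart hK hψs hψ hψp hρ₁ hρ₁r hθ hθ1 hbρ hbK hτ hv hsupp hnorm

end Summit.SmoothPoincare4.SmoothPoincare4.Theorems

end
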